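import Summits.QuantumAdvantage.QuantumAdvantage.Theorems.AnchorDialCore
import Summits.QuantumAdvantage.QuantumAdvantage.Theorems.AnchorDialFrozen

/-!
# AnchorDial — Orbit (cell decomp-qadv, seat lens-2, generation 14 rev 2; supports item 26531 `ExactnessDial.PolyLossOddU3`)

§7 of the node: the **ORBIT LAW** — the pointwise bridge from the ring game to the four-flip core (part 1, `AnchorDialCore`).
`orb` (the 16-point orbit of four far adjacent pair-flips), `cN_orb` (kernel phases along the orbit: `c_k(x^ε) ≡ c_k(x) + Σ ε_i(1+[b_i+1 ≤ k])σ_i`,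
the four signs read off `x`), `sgnVec` (effective sign vector), `ptrData` (the value the hidden trit must avoid: `2` at the anchor, `1` one step on;
reflected by `Core.refl 1` when the hidden entrance parity is `1`), **`orbit_avoids`** / **`orbit_law`** (sixteen wins with a common anchor off the
flip sites put `sgnVec` into `Core.Compat₂ 1 (ptrData s)` — at most 10 of 16 vectors, `orbit_law_card`), `orbit_law_cert` (the same in the
certificate currency of `MovingPointerLoss3`); §7b the WRAP anchor `k = n-1` (`cN_wrap`, `orbit_avoids_wrap`, `orbit_law_wrap`: plain
`Core.Compat`, ≤ 5/16, no hidden bit), the orbit involution `orb_orb`, `card_filter_orb` and the sixteen-fold union bound `card_exists_orb_le`.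

Split (≤ 400 lines, part 4/5) of the node file `HOME/decomp-qadv-lens-2/g14/AnchorDial.lean` (rev 2; sha256 in SHA256SUMS.txt, farm rc 0, no
placeholders); declarations verbatim, namespace `Summit.QuantumAdvantage.QuantumAdvantage.Theorems.AnchorDial`.  Record: NODE-g14.md.
-/

set_option linter.dupNamespace false
set_option linter.unusedVariables false

noncomputable section

open scoped Classical

namespace Summit.QuantumAdvantage.QuantumAdvantage.Theorems.AnchorDial

open Finset
open Literature.Computability.QuantumComplexity Literature.Computability.QuantumComplexity.RingHLF
open Literature.Computability.MetaComplexity Literature.Computability.MetaComplexity.Smolensky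
open Summit.QuantumAdvantage.AdviceFreeQNC0
-- only the tree gadgets we use (the g13 package keeps landing under `Theorems.HolonomyDial`; no blanket `open`)
open Summit.QuantumAdvantage.QuantumAdvantage.Theorems.HolonomyDial (gCond)

variable {N : ℕ}

/-! ## §7 The ORBIT LAW: sixteen certified wins put the sign vector into the core's compatible set
(pointwise bridge from the ring game to §4 — the engine's remaining input is equidistribution of `sgnVec`) -/

section Orbit

/-- optional adjacent pair-flip at site `a`. -/
def fz : Bool → ℕ → (Fin N → Bool) → Fin N → Bool
  | true, a, x => flip2 a (a + 1) x
  | false, _, x => x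

/-- the 16-point ORBIT of `x` under the four adjacent pair-flips at sites `b₁ < b₂ < b₃ < b₄`. -/
def orb (b₁ b₂ b₃ b₄ : ℕ) (ε : Core.B4) (x : Fin N → Bool) : Fin N → Bool :=
  fz ε.1 b₁ (fz ε.2.1 b₂ (fz ε.2.2.1 b₃ (fz ε.2.2.2 b₄ x)))

/-- AnchorDialOrbit helper `zpar_fz` (decomp-qadv land package; see the module docstring). -/
theorem zpar_fz (e : Bool) {a : ℕ} (ha : a + 2 ≤ N) (x : Fin N → Bool) (k : ℕ) (hk : k ≤ N) (hne : k ≠ a + 1) :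
    zpar (fz e a x) k = zpar x k := by
  cases e
  · rfl
  · show zpar (flip2 a (a + 1) x) k = zpar x k
    rw [zpar_flip2 (show a < a + 1 by omega) x k hk, if_neg (by omega)]

/-- AnchorDialOrbit helper `oddZeros_fz` (decomp-qadv land package; see the module docstring). -/
theorem oddZeros_fz (e : Bool) {a : ℕ} (ha : a + 2 ≤ N) (x : Fin N → Bool) : OddZeros (fz e a x) ↔ OddZeros x := by
  cases e
  · rfl
  · exact oddZeros_flip2 (show a < a + 1 by omega) (by omega) x

/-- AnchorDialOrbit helper `oddZeros_orb` (decomp-qadv land package; see the module docstring). -/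
theorem oddZeros_orb {b₁ b₂ b₃ b₄ : ℕ} (h1 : b₁ + 2 ≤ N) (h2 : b₂ + 2 ≤ N) (h3 : b₃ + 2 ≤ N) (h4 : b₄ + 2 ≤ N)
    (ε : Core.B4) (x : Fin N → Bool) : OddZeros (orb b₁ b₂ b₃ b₄ ε x) ↔ OddZeros x := by
  unfold orb
  rw [oddZeros_fz _ h1, oddZeros_fz _ h2, oddZeros_fz _ h3, oddZeros_fz _ h4]

/-- the phase SHIFT of an optional flip: `[e]·(1 + [past])·σ` with `σ = sgN z`. -/
def sh : Bool → Bool → Bool → ℕ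
  | true, p, z => (if p = true then 2 else 1) * sgN z
  | false, _, _ => 0

/-- AnchorDialOrbit helper `cN_fz` (decomp-qadv land package; see the module docstring). -/
theorem cN_fz (x : Fin N → Bool) {a : ℕ} (ha : a + 3 ≤ N) (k : ℕ) (hk : k ≤ N) (e : Bool) :
    cN (fz e a x) k % 3 = (cN x k + sh e (decide (a + 1 ≤ k)) (zpar x (a + 1))) % 3 := by
  cases e
  · simp [fz, sh]
  · have h := cN_flipAdj x ha k hk
    show cN (flip2 a (a + 1) x) k % 3 = (cN x k + (if decide (a + 1 ≤ k) = true then 2 else 1) * sgN (zpar x (a + 1))) % 3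
    rw [h]
    by_cases hp : a + 1 ≤ k
    · rw [if_pos hp, if_pos (decide_eq_true hp)]
    · rw [if_neg hp, if_neg (by simpa using hp)]

/-- **kernel phases along the orbit**: `c_k(x^ε) ≡ c_k(x) + Σ_i ε_i (1 + [b_i + 1 ≤ k]) σ_i (mod 3)` — the four hidden
SIGNS `σ_i = sgN (zpar x (b_i + 1))` are read off `x` (each flip moves only its own parity site). -/
theorem cN_orb (x : Fin N → Bool) {b₁ b₂ b₃ b₄ : ℕ} (h12 : b₁ + 2 ≤ b₂) (h23 : b₂ + 2 ≤ b₃) (h34 : b₃ + 2 ≤ b₄)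
    (h4N : b₄ + 3 ≤ N) (ε : Core.B4) (k : ℕ) (hk : k ≤ N) :
    cN (orb b₁ b₂ b₃ b₄ ε x) k % 3 = (cN x k + sh ε.1 (decide (b₁ + 1 ≤ k)) (zpar x (b₁ + 1))
      + sh ε.2.1 (decide (b₂ + 1 ≤ k)) (zpar x (b₂ + 1)) + sh ε.2.2.1 (decide (b₃ + 1 ≤ k)) (zpar x (b₃ + 1))
      + sh ε.2.2.2 (decide (b₄ + 1 ≤ k)) (zpar x (b₄ + 1))) % 3 := by
  obtain ⟨e₁, e₂, e₃, e₄⟩ := ε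
  dsimp only [orb]
  have s4 := cN_fz x h4N k hk e₄
  have s3 := cN_fz (fz e₄ b₄ x) (show b₃ + 3 ≤ N by omega) k hk e₃
  have s2 := cN_fz (fz e₃ b₃ (fz e₄ b₄ x)) (show b₂ + 3 ≤ N by omega) k hk e₂
  have s1 := cN_fz (fz e₂ b₂ (fz e₃ b₃ (fz e₄ b₄ x))) (show b₁ + 3 ≤ N by omega) k hk e₁
  have z3 : zpar (fz e₄ b₄ x) (b₃ + 1) = zpar x (b₃ + 1) := zpar_fz e₄ (by omega) x _ (by omega) (by omega)
  have z2 : zpar (fz e₃ b₃ (fz e₄ b₄ x)) (b₂ + 1) = zpar x (b₂ + 1) := by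
    rw [zpar_fz e₃ (by omega) _ _ (by omega) (by omega), zpar_fz e₄ (by omega) x _ (by omega) (by omega)]
  have z1 : zpar (fz e₂ b₂ (fz e₃ b₃ (fz e₄ b₄ x))) (b₁ + 1) = zpar x (b₁ + 1) := by
    rw [zpar_fz e₂ (by omega) _ _ (by omega) (by omega), zpar_fz e₃ (by omega) _ _ (by omega) (by omega),
      zpar_fz e₄ (by omega) x _ (by omega) (by omega)]
  rw [z3] at s3
  rw [z2] at s2
  rw [z1] at s1
  omega

/-- the EFFECTIVE SIGN VECTOR of `x` seen from position `k`: the sign bit of each flip, negated past the flip. -/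
def sgnVec (b₁ b₂ b₃ b₄ : ℕ) (x : Fin N → Bool) (k : ℕ) : Core.B4 :=
  (xor (zpar x (b₁ + 1)) (decide (b₁ + 1 ≤ k)), xor (zpar x (b₂ + 1)) (decide (b₂ + 1 ≤ k)),
    xor (zpar x (b₃ + 1)) (decide (b₃ + 1 ≤ k)), xor (zpar x (b₄ + 1)) (decide (b₄ + 1 ≤ k)))

/-- AnchorDialOrbit helper `sh_cast` (decomp-qadv land package; see the module docstring). -/
theorem sh_cast (e p z : Bool) : ((sh e p z : ℕ) : ZMod 3) = Core.ct e (xor z p) := by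
  cases e <;> cases p <;> cases z <;> simp [sh, sgN, Core.ct, Core.sg]
  decide

/-- AnchorDialOrbit helper `mod3_ne_two_iff` (decomp-qadv land package; see the module docstring). -/
theorem mod3_ne_two_iff (v : ℕ) : v % 3 ≠ 2 ↔ (v : ZMod 3) ≠ 2 := by
  have h2 : (2 : ZMod 3) = ((2 : ℕ) : ZMod 3) := by norm_num
  rw [h2, Ne, Ne, ZMod.natCast_eq_natCast_iff']

/-- AnchorDialOrbit helper `cN_succ` (decomp-qadv land package; see the module docstring). -/
theorem cN_succ (x : Fin N → Bool) (k : ℕ) (hk : k < N) :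
    cN x (k + 1) = cN x k + 1 + (if zpar x (k + 1) = true then 1 else 0) := by
  unfold cN
  rw [Wk_succ x hk, uCoord_eq_zpar]
  simp only
  split_ifs <;> omega

/-- the pointer's DATA on the orbit, read with entrance parity `u = 0`: the value the hidden trit must AVOID is `2`
when the bet is at the anchor (`s ε = false`) and `1` when it is at the next position (`s ε = true`); with `u = 1`
the data is the reflection `Core.refl 1` of this (`1 ↦ 0`, `2 ↦ 2`). -/
def ptrData (s : Core.B4 → Bool) (ε : Core.B4) : ZMod 3 := if s ε = true then 1 else 2

/-- **THE ORBIT LAW (avoidance form)**: a moving pointer with common anchor `k` (off the flip sites) and selector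
bits `s` that hits a kernel position at ALL 16 orbit points makes the data avoid the orbit line of the hidden trit
`c_k(x)` with the effective sign vector — reflected or not according to the hidden entrance parity `zpar x (k+1)`. -/
theorem orbit_avoids (x : Fin N → Bool) {b₁ b₂ b₃ b₄ : ℕ} (h12 : b₁ + 2 ≤ b₂) (h23 : b₂ + 2 ≤ b₃)
    (h34 : b₃ + 2 ≤ b₄) (h4N : b₄ + 3 ≤ N) (k : ℕ) (hk : k + 1 < N)
    (hkb : k ≠ b₁ ∧ k ≠ b₂ ∧ k ≠ b₃ ∧ k ≠ b₄) (s : Core.B4 → Bool)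
    (hwin : ∀ ε, gCond (orb b₁ b₂ b₃ b₄ ε x) (k + (if s ε = true then 1 else 0))) :
    Core.Avoids (if zpar x (k + 1) = true then Core.refl 1 (ptrData s) else ptrData s)
      (sgnVec b₁ b₂ b₃ b₄ x k) ((cN x k : ℕ) : ZMod 3) := by
  unfold Core.Avoids
  intro ε
  have hw := hwin ε
  rw [gCond_iff_cN] at hw
  have hlv : Core.lv (sgnVec b₁ b₂ b₃ b₄ x k) ((cN x k : ℕ) : ZMod 3) ε =
      ((cN x k : ℕ) : ZMod 3) + Core.ct ε.1 (xor (zpar x (b₁ + 1)) (decide (b₁ + 1 ≤ k)))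
        + Core.ct ε.2.1 (xor (zpar x (b₂ + 1)) (decide (b₂ + 1 ≤ k)))
        + Core.ct ε.2.2.1 (xor (zpar x (b₃ + 1)) (decide (b₃ + 1 ≤ k)))
        + Core.ct ε.2.2.2 (xor (zpar x (b₄ + 1)) (decide (b₄ + 1 ≤ k))) := rfl
  rw [ite_apply, hlv]
  by_cases hs : s ε = true
  · -- bet at `k + 1`
    rw [if_pos hs] at hw
    have d₁ : decide (b₁ + 1 ≤ k + 1) = decide (b₁ + 1 ≤ k) := by rw [decide_eq_decide]; omega
    have d₂ : decide (b₂ + 1 ≤ k + 1) = decide (b₂ + 1 ≤ k) := by rw [decide_eq_decide]; omega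
    have d₃ : decide (b₃ + 1 ≤ k + 1) = decide (b₃ + 1 ≤ k) := by rw [decide_eq_decide]; omega
    have d₄ : decide (b₄ + 1 ≤ k + 1) = decide (b₄ + 1 ≤ k) := by rw [decide_eq_decide]; omega
    rw [cN_orb x h12 h23 h34 h4N ε (k + 1) (by omega), d₁, d₂, d₃, d₄, cN_succ x k (by omega),
      mod3_ne_two_iff] at hw
    push_cast [sh_cast] at hw
    have hr : (if zpar x (k + 1) = true then Core.refl 1 (ptrData s) ε else ptrData s ε) =
        if zpar x (k + 1) = true then 0 else 1 := by
      unfold Core.refl ptrData; rw [if_pos hs]; split_ifs <;> decide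
    rw [hr]
    by_cases hu : zpar x (k + 1) = true
    · rw [if_pos hu] at hw ⊢
      intro h; apply hw; linear_combination (-1 : ZMod 3) * h
    · rw [if_neg hu] at hw ⊢
      intro h; apply hw; linear_combination (-1 : ZMod 3) * h
  · -- bet at the anchor `k`
    rw [if_neg hs, Nat.add_zero, cN_orb x h12 h23 h34 h4N ε k (by omega), mod3_ne_two_iff] at hw
    push_cast [sh_cast] at hw
    have hr : (if zpar x (k + 1) = true then Core.refl 1 (ptrData s) ε else ptrData s ε) = 2 := by
      unfold Core.refl ptrData; rw [if_neg hs]; split_ifs <;> decide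
    rw [hr]
    intro h; apply hw; rw [← h]

/-- **THE ORBIT LAW**: sixteen certified wins force the effective sign vector of `x` into the COMPATIBLE SET of the
pointer data — at most 10 of the 16 sign vectors by `Core.core_four`.  (The engine for `MovingPointerLoss3` needs
exactly one more input: Smolensky equidistribution of `sgnVec` on the polylog-degree events fixing the data.) -/
theorem orbit_law (x : Fin N → Bool) {b₁ b₂ b₃ b₄ : ℕ} (h12 : b₁ + 2 ≤ b₂) (h23 : b₂ + 2 ≤ b₃)
    (h34 : b₃ + 2 ≤ b₄) (h4N : b₄ + 3 ≤ N) (k : ℕ) (hk : k + 1 < N)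
    (hkb : k ≠ b₁ ∧ k ≠ b₂ ∧ k ≠ b₃ ∧ k ≠ b₄) (s : Core.B4 → Bool)
    (hwin : ∀ ε, gCond (orb b₁ b₂ b₃ b₄ ε x) (k + (if s ε = true then 1 else 0))) :
    sgnVec b₁ b₂ b₃ b₄ x k ∈ univ.filter fun σ => Core.Compat₂ 1 (ptrData s) σ := by
  rw [mem_filter]
  refine ⟨mem_univ _, ?_⟩
  have h := orbit_avoids x h12 h23 h34 h4N k hk hkb s hwin
  by_cases hu : zpar x (k + 1) = true
  · rw [if_pos hu] at h; exact Or.inr ⟨_, h⟩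
  · rw [if_neg hu] at h; exact Or.inl ⟨_, h⟩

/-- the orbit law in the CERTIFICATE currency of `MovingPointerLoss3`: common declared anchor `k` along the orbit and
certified wins at all 16 points. -/
theorem orbit_law_cert (A f : Fin N → CubeFn (ZMod 3) N) (x : Fin N → Bool) {b₁ b₂ b₃ b₄ : ℕ}
    (h12 : b₁ + 2 ≤ b₂) (h23 : b₂ + 2 ≤ b₃) (h34 : b₃ + 2 ≤ b₄) (h4N : b₄ + 3 ≤ N) (k : Fin N)
    (hk : k.val + 1 < N) (hkb : k.val ≠ b₁ ∧ k.val ≠ b₂ ∧ k.val ≠ b₃ ∧ k.val ≠ b₄)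
    (hanch : ∀ ε, A k (orb b₁ b₂ b₃ b₄ ε x) = 1)
    (hcert : ∀ ε, ∃ k' : Fin N, (univ.filter fun k'' : Fin N => A k'' (orb b₁ b₂ b₃ b₄ ε x) = 1) = {k'} ∧
      gCond (orb b₁ b₂ b₃ b₄ ε x) ((k'.val + (if f k' (orb b₁ b₂ b₃ b₄ ε x) = 1 then 0 else 1)) % N)) :
    sgnVec b₁ b₂ b₃ b₄ x k.val ∈
      univ.filter fun σ => Core.Compat₂ 1 (ptrData fun ε => !decide (f k (orb b₁ b₂ b₃ b₄ ε x) = 1)) σ := by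
  refine orbit_law x h12 h23 h34 h4N k.val hk hkb _ fun ε => ?_
  obtain ⟨k', hk', hg⟩ := hcert ε
  have hkk : k = k' := by
    have h : k ∈ univ.filter fun k'' : Fin N => A k'' (orb b₁ b₂ b₃ b₄ ε x) = 1 := mem_filter.2 ⟨mem_univ _, hanch ε⟩
    rw [hk', mem_singleton] at h
    exact h
  subst hkk
  by_cases hf : f k (orb b₁ b₂ b₃ b₄ ε x) = 1
  · rw [if_pos hf, Nat.add_zero, Nat.mod_eq_of_lt k.isLt] at hg
    simpa [hf] using hg
  · rw [if_neg hf, Nat.mod_eq_of_lt hk] at hg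
    simpa [hf] using hg

/-- the compatible set met by the orbit law has at most 10 of the 16 sign vectors (§4). -/
theorem orbit_law_card (s : Core.B4 → Bool) : (univ.filter fun σ => Core.Compat₂ 1 (ptrData s) σ).card ≤ 10 :=
  Core.core_four 1 (ptrData s)


/-! ### §7b  the WRAP anchor (`k = n-1`, bets at `n-1` and `0`): no hidden bit, plain `Core.Compat` (≤ 5/16);
orbit involution and the sixteen-fold union bound used by the count -/

/-- AnchorDialOrbit helper `cN_wrap` (decomp-qadv land package; see the module docstring). -/
theorem cN_wrap (x : Fin N → Bool) (hN : 1 ≤ N) : cN x (N - 1) + 1 = 2 * cN x 0 := by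
  unfold cN; rw [Wk_zero]; omega

/-- data of the wrap anchor: avoid `0` when betting at `n-1`, avoid `2` when betting at `0` (trit `τ₀ = c_0(x)`). -/
def wrapData (s : Core.B4 → Bool) (ε : Core.B4) : ZMod 3 := if s ε = true then 2 else 0

/-- AnchorDialOrbit helper `ct_past` (decomp-qadv land package; see the module docstring). -/
theorem ct_past (e z : Bool) : Core.ct e (xor z true) = -Core.ct e (xor z false) := by
  cases e <;> cases z <;> decide

/-- **orbit law at the wrap anchor**: sixteen wins with common anchor `n-1` make `wrapData` avoid the orbit line of
`c_0(x)` with the RAW sign vector — no reflection (the phase `c_{n-1} ≡ 2c_0 - 1` is tied to `c_0`). -/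
theorem orbit_avoids_wrap (x : Fin N → Bool) {b₁ b₂ b₃ b₄ : ℕ} (h12 : b₁ + 2 ≤ b₂) (h23 : b₂ + 2 ≤ b₃)
    (h34 : b₃ + 2 ≤ b₄) (h4N : b₄ + 3 ≤ N) (s : Core.B4 → Bool)
    (hwin : ∀ ε, gCond (orb b₁ b₂ b₃ b₄ ε x) ((N - 1 + (if s ε = true then 1 else 0)) % N)) :
    Core.Avoids (wrapData s) (sgnVec b₁ b₂ b₃ b₄ x 0) ((cN x 0 : ℕ) : ZMod 3) := by
  unfold Core.Avoids
  intro ε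
  have hw := hwin ε
  rw [gCond_iff_cN] at hw
  have hlv : Core.lv (sgnVec b₁ b₂ b₃ b₄ x 0) ((cN x 0 : ℕ) : ZMod 3) ε =
      ((cN x 0 : ℕ) : ZMod 3) + Core.ct ε.1 (xor (zpar x (b₁ + 1)) (decide (b₁ + 1 ≤ 0)))
        + Core.ct ε.2.1 (xor (zpar x (b₂ + 1)) (decide (b₂ + 1 ≤ 0)))
        + Core.ct ε.2.2.1 (xor (zpar x (b₃ + 1)) (decide (b₃ + 1 ≤ 0)))
        + Core.ct ε.2.2.2 (xor (zpar x (b₄ + 1)) (decide (b₄ + 1 ≤ 0))) := rfl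
  rw [hlv]
  have e₁ : decide (b₁ + 1 ≤ 0) = false := by rw [decide_eq_false_iff_not]; omega
  have e₂ : decide (b₂ + 1 ≤ 0) = false := by rw [decide_eq_false_iff_not]; omega
  have e₃ : decide (b₃ + 1 ≤ 0) = false := by rw [decide_eq_false_iff_not]; omega
  have e₄ : decide (b₄ + 1 ≤ 0) = false := by rw [decide_eq_false_iff_not]; omega
  by_cases hs : s ε = true
  · -- bet at position `0`
    rw [if_pos hs, Nat.sub_add_cancel (show 1 ≤ N by omega), Nat.mod_self,
      cN_orb x h12 h23 h34 h4N ε 0 (by omega), mod3_ne_two_iff] at hw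
    rw [e₁, e₂, e₃, e₄] at hw ⊢
    simp only [Nat.cast_add, sh_cast] at hw
    have hr : wrapData s ε = 2 := by unfold wrapData; rw [if_pos hs]
    rw [hr]
    intro h; apply hw; rw [← h]
  · -- bet at position `n - 1`
    rw [if_neg hs, Nat.add_zero, Nat.mod_eq_of_lt (show N - 1 < N by omega),
      cN_orb x h12 h23 h34 h4N ε (N - 1) (by omega), mod3_ne_two_iff] at hw
    have d₁ : decide (b₁ + 1 ≤ N - 1) = true := by rw [decide_eq_true_iff]; omega
    have d₂ : decide (b₂ + 1 ≤ N - 1) = true := by rw [decide_eq_true_iff]; omega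
    have d₃ : decide (b₃ + 1 ≤ N - 1) = true := by rw [decide_eq_true_iff]; omega
    have d₄ : decide (b₄ + 1 ≤ N - 1) = true := by rw [decide_eq_true_iff]; omega
    rw [d₁, d₂, d₃, d₄] at hw
    simp only [Nat.cast_add, sh_cast] at hw
    rw [ct_past, ct_past, ct_past, ct_past] at hw
    rw [e₁, e₂, e₃, e₄]
    have hτ : ((cN x (N - 1) : ℕ) : ZMod 3) = 2 * ((cN x 0 : ℕ) : ZMod 3) - 1 := by
      have h := congrArg (Nat.cast : ℕ → ZMod 3) (cN_wrap x (show 1 ≤ N by omega))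
      push_cast at h
      linear_combination h
    rw [hτ] at hw
    have hr : wrapData s ε = 0 := by unfold wrapData; rw [if_neg hs]
    rw [hr]
    have h3 : (3 : ZMod 3) = 0 := by decide
    intro h; apply hw
    linear_combination h + (((cN x 0 : ℕ) : ZMod 3) - 1) * h3

/-- the wrap orbit law: the raw sign vector lies in the compatible set of `wrapData s` — at most 5 of 16
(`Core.card_compat_le_five`). -/
theorem orbit_law_wrap (x : Fin N → Bool) {b₁ b₂ b₃ b₄ : ℕ} (h12 : b₁ + 2 ≤ b₂) (h23 : b₂ + 2 ≤ b₃)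
    (h34 : b₃ + 2 ≤ b₄) (h4N : b₄ + 3 ≤ N) (s : Core.B4 → Bool)
    (hwin : ∀ ε, gCond (orb b₁ b₂ b₃ b₄ ε x) ((N - 1 + (if s ε = true then 1 else 0)) % N)) :
    sgnVec b₁ b₂ b₃ b₄ x 0 ∈ univ.filter fun σ => Core.Compat (wrapData s) σ :=
  mem_filter.2 ⟨mem_univ _, _, orbit_avoids_wrap x h12 h23 h34 h4N s hwin⟩

/-- AnchorDialOrbit helper `orbit_law_wrap_card` (decomp-qadv land package; see the module docstring). -/
theorem orbit_law_wrap_card (s : Core.B4 → Bool) : (univ.filter fun σ => Core.Compat (wrapData s) σ).card ≤ 5 :=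
  Core.card_compat_le_five (wrapData s)

/-- AnchorDialOrbit helper `fz_apply` (decomp-qadv land package; see the module docstring). -/
theorem fz_apply (e : Bool) (a : ℕ) (x : Fin N → Bool) (j : Fin N) :
    fz e a x j = if e = true ∧ (j.val = a ∨ j.val = a + 1) then !x j else x j := by
  cases e <;> simp [fz, flip2]

/-- each orbit map is an involution (the four flips commute). -/
theorem orb_orb (b₁ b₂ b₃ b₄ : ℕ) (ε : Core.B4) (x : Fin N → Bool) :
    orb b₁ b₂ b₃ b₄ ε (orb b₁ b₂ b₃ b₄ ε x) = x := by
  funext j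
  simp only [orb, fz_apply]
  split_ifs <;> simp

/-- AnchorDialOrbit helper `card_filter_orb` (decomp-qadv land package; see the module docstring). -/
theorem card_filter_orb (b₁ b₂ b₃ b₄ : ℕ) (ε : Core.B4) (Q : (Fin N → Bool) → Prop) [DecidablePred Q] :
    (univ.filter fun x : Fin N → Bool => Q (orb b₁ b₂ b₃ b₄ ε x)).card = (univ.filter fun x => Q x).card := by
  refine Finset.card_bij (fun x _ => orb b₁ b₂ b₃ b₄ ε x) (fun x hx => ?_) (fun x₁ _ x₂ _ h => ?_) (fun y hy => ?_)
  · rw [mem_filter] at hx ⊢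
    exact ⟨mem_univ _, hx.2⟩
  · have h' := congrArg (orb b₁ b₂ b₃ b₄ ε) h
    simpa only [orb_orb] using h'
  · refine ⟨orb b₁ b₂ b₃ b₄ ε y, ?_, orb_orb b₁ b₂ b₃ b₄ ε y⟩
    rw [mem_filter] at hy ⊢
    refine ⟨mem_univ _, ?_⟩
    rw [orb_orb]; exact hy.2

/-- AnchorDialOrbit helper `card_B4` (decomp-qadv land package; see the module docstring). -/
theorem card_B4 : Fintype.card Core.B4 = 16 := by
  simp [Core.B4, Fintype.card_prod, Fintype.card_bool]

/-- **sixteen-fold union bound**: the inputs some point of whose orbit lies in `R` number at most `16·#R`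
(used with `R` = the odd non-certified-winning inputs: every good all-but-one-winning orbit is charged to a loser). -/
theorem card_exists_orb_le (b₁ b₂ b₃ b₄ : ℕ) (R : (Fin N → Bool) → Prop) [DecidablePred R] :
    (univ.filter fun x : Fin N → Bool => ∃ ε : Core.B4, R (orb b₁ b₂ b₃ b₄ ε x)).card
      ≤ 16 * (univ.filter fun x => R x).card := by
  calc (univ.filter fun x : Fin N → Bool => ∃ ε : Core.B4, R (orb b₁ b₂ b₃ b₄ ε x)).card
      ≤ (univ.biUnion fun ε : Core.B4 => univ.filter fun x : Fin N → Bool => R (orb b₁ b₂ b₃ b₄ ε x)).card := by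
        refine card_le_card fun x hx => ?_
        rw [mem_filter] at hx
        obtain ⟨ε, hε⟩ := hx.2
        rw [mem_biUnion]
        exact ⟨ε, mem_univ _, mem_filter.2 ⟨mem_univ _, hε⟩⟩
    _ ≤ ∑ ε : Core.B4, (univ.filter fun x : Fin N → Bool => R (orb b₁ b₂ b₃ b₄ ε x)).card := card_biUnion_le
    _ = ∑ ε : Core.B4, (univ.filter fun x => R x).card := by
        refine sum_congr rfl fun ε _ => ?_
        exact card_filter_orb b₁ b₂ b₃ b₄ ε R
    _ = 16 * (univ.filter fun x => R x).card := by rw [sum_const, card_univ, card_B4, smul_eq_mul]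

end Orbit

end Summit.QuantumAdvantage.QuantumAdvantage.Theorems.AnchorDial

end
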